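import Mathlib
import Summits.NavierStokesRegularity.OSWSelfSimilar.TypeIIModulatedAnsatz
import HarnessLib
/-!
# The algebraic cores of the gauge functionals (zone Z1 TEMPLATE §T1.3 (G1a), (G2c) — kernel-checked modulo the
# argmax calculus)

HONEST FRAMING (cell ns-blowup GROUP B «PROFILE SEARCH», zone Z1 «Type-II log-modulated DSS ansatz for axisymmetric
Navier–Stokes — the template IS the deliverable»; D-0035/D-0074): part IX of the Z1 dictionary. TEMPLATE §T1.3 fixes the
scale `λ(t)` by a normalisation and reads the modulation `a(τ)` off the rescaled equation at the normalisation point: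

* (G1a) gauge N-a (`‖V(·, τ)‖_∞ ≡ 1` attained at `y_m(τ)`): `a(τ) = [V·(νΔV − ∇Π)](y_m(τ), τ)` — «from
  `d/dτ Φ(y_m(τ), τ) = 0`, `∇Φ(y_m) = 0` (so `V·(y·∇)V = V·(V·∇)V = V·∂_zV = 0` there) and `|V(y_m)| = 1`», `Φ = ½|V|²`;
* (G2c) gauge N-b′ (`‖U₁(·, τ)‖_∞ ≡ 1` attained at `y₁(τ)`): `a(τ) = ∂_zΨ₁(y₁, τ) + ½ L₃U₁(y₁, τ)` from (E7a) at the maximum.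

§T1.18 (K6)/§T1.19 (K12) list these as NOT typed because the ARGMAX CALCULUS (existence and differentiability of the
maximum curve `τ ↦ y_m(τ)`, hence `V(y_m)·∂_τV(y_m) = 0`) is paper. This file kernel-checks the ALGEBRAIC CORE that remains
once those argmax facts are granted as hypotheses, as identities in an arbitrary real inner product space / in `ℝ`:

* `modulation_eq_inner_of_critical` — (G1a): if at a point the modulated equation (Z1-E)
  `∂_τV + a ΛV + ζ·∇V + (V·∇)V + ∇Π = νΔV` holds (as an identity between the VALUES `Vτ, V₀, DV, ∇Π, ΔV` there), the
  point is critical for `½|V|²` (`⟪V₀, DV w⟫ = 0` for all `w`), `‖V₀‖ = 1`, and `⟪V₀, Vτ⟫ = 0`, then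
  `a = ⟪V₀, νΔV − ∇Π⟫`; the un-normalised form `a ‖V₀‖² = ⟪V₀, νΔV − ∇Π⟫` (`modulation_mul_normSq_eq_inner_of_critical`)
  needs no `‖V₀‖ = 1`;
* `modulation_eq_of_max_angular` — (G2c): if at a point the modulated Hou–Li equation (E7a)
  `∂_τU₁ + a(2U₁ + y·∇U₁) + ζ ∂_zU₁ + (b·∇)U₁ = 2U₁ ∂_zΨ₁ + L₃U₁` holds between the values there, with `U₁ = 1`,
  `y·∇U₁ = ∂_zU₁ = (b·∇)U₁ = 0` (critical point) and `∂_τU₁ = 0` (normalisation along the maximum curve), then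
  `a = ∂_zΨ₁ + ½ L₃U₁`.

**Nothing here is a statement about a Navier–Stokes solution**, nor does it construct the maximum curve: finite-dimensional
linear algebra. «violates: n/a — dictionary»; bears_on LADDER-NS N5/Z1 → N1 linear core / N0⁻.
Author: ns-blowup-profile-eng-1 g5, 2026-08-27.
-/

open Real InnerProductSpace
open scoped RealInnerProductSpace

namespace Summit.NavierStokesRegularity.OSWSelfSimilar
namespace TypeIIModulationDictionary

section GaugeNa

variable {E : Type*} [NormedAddCommGroup E] [InnerProductSpace ℝ E]

/-- **TEMPLATE (G1a), un-normalised algebraic core.** Let the values at one point satisfy the modulated equation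
`Vτ + a • (V₀ + DV y) + DV ζ + DV V₀ + ∇Π = ν • ΔV` ((Z1-E): `∂_τV + aΛV + ζ·∇V + (V·∇)V + ∇Π = νΔV`, `ΛV = V + DV y`), let the
point be critical for `½|V|²` (`⟪V₀, DV w⟫ = 0` for every `w`) and let `⟪V₀, Vτ⟫ = 0` (the normalisation is preserved
along the maximum curve). Then `a ‖V₀‖² = ⟪V₀, ν • ΔV − ∇Π⟫`. [new here — dictionary] -/
theorem modulation_mul_normSq_eq_inner_of_critical {Vτ V₀ LapV gradP y ζ : E} {DV : E →L[ℝ] E} {a ν : ℝ}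
    (heq : Vτ + a • (V₀ + DV y) + DV ζ + DV V₀ + gradP = ν • LapV)
    (hcrit : ∀ w, ⟪V₀, DV w⟫ = 0) (horth : ⟪V₀, Vτ⟫ = 0) :
    a * ‖V₀‖ ^ 2 = ⟪V₀, ν • LapV - gradP⟫ := by
  have h := congrArg (fun v => ⟪V₀, v⟫) heq
  simp only [inner_add_right, inner_smul_right, hcrit, horth, add_zero, zero_add] at h
  rw [inner_sub_right, inner_smul_right, ← h, real_inner_self_eq_norm_sq]
  ring

/-- **TEMPLATE (G1a): `a(τ) = [V·(νΔV − ∇Π)](y_m(τ), τ)` in gauge N-a**, algebraic core: under the hypotheses of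
`modulation_mul_normSq_eq_inner_of_critical` and the normalisation `‖V₀‖ = 1` (`‖V(·, τ)‖_∞ ≡ 1` attained at `y_m`),
`a = ⟪V₀, ν • ΔV − ∇Π⟫`. The drift `ζ` does not enter ((G1a): «ζ does not enter»). [new here — dictionary] -/
theorem modulation_eq_inner_of_critical {Vτ V₀ LapV gradP y ζ : E} {DV : E →L[ℝ] E} {a ν : ℝ}
    (heq : Vτ + a • (V₀ + DV y) + DV ζ + DV V₀ + gradP = ν • LapV)
    (hcrit : ∀ w, ⟪V₀, DV w⟫ = 0) (hnorm : ‖V₀‖ = 1) (horth : ⟪V₀, Vτ⟫ = 0) :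
    a = ⟪V₀, ν • LapV - gradP⟫ := by
  have h := modulation_mul_normSq_eq_inner_of_critical heq hcrit horth
  rwa [hnorm, one_pow, mul_one] at h

/-- **The normalisation hypothesis from the chain rule.** If `τ ↦ ½‖V(y_m(τ), τ)‖²` is constant (gauge N-a) and the
point is critical, then `⟪V₀, Vτ⟫ = 0`: precisely, if a real function `Φm` (the composite `Φ(y_m(τ), τ)`) has derivative
`⟪V₀, Vτ⟫ + ⟪V₀, DV ẏ⟫` at `τ` (chain rule along the maximum curve, `ẏ` the velocity of `y_m`) and is constant near `τ`, and `⟪V₀, DV ẏ⟫ = 0`, then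
`⟪V₀, Vτ⟫ = 0`. [new here — dictionary] -/
theorem inner_timeDeriv_eq_zero_of_const {Φm : ℝ → ℝ} {τ : ℝ} {V₀ Vτ dy : E} {DV : E →L[ℝ] E}
    (hderiv : HasDerivAt Φm (⟪V₀, Vτ⟫ + ⟪V₀, DV dy⟫) τ) (hconst : ∀ᶠ σ in nhds τ, Φm σ = Φm τ)
    (hcrit : ⟪V₀, DV dy⟫ = 0) : ⟪V₀, Vτ⟫ = 0 := by
  have h0 : HasDerivAt Φm 0 τ := by
    have hc : HasDerivAt (fun _ : ℝ => Φm τ) 0 τ := hasDerivAt_const τ (Φm τ)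
    exact hc.congr_of_eventuallyEq hconst
  have := hderiv.unique h0
  rwa [hcrit, add_zero] at this

end GaugeNa

section GaugeNb

/-- **TEMPLATE (G2c): `a(τ) = ∂_zΨ₁(y₁, τ) + ½ L₃U₁(y₁, τ)` in gauge N-b′**, algebraic core: if the values at one point
satisfy the modulated Hou–Li equation (E7a) `U₁τ + a(2U₁ + yGradU₁) + ζ U₁z + convU₁ = 2 U₁ Ψ₁z + L₃U₁`, and at that point
`U₁ = 1` (normalisation `‖U₁(·, τ)‖_∞ ≡ 1` attained), `yGradU₁ = U₁z = convU₁ = 0` (critical point: `y·∇U₁ = ∂_zU₁ =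
(b·∇)U₁ = 0`) and `U₁τ = 0` (normalisation preserved along the maximum curve), then `a = Ψ₁z + L₃U₁ / 2`.
[new here — dictionary] -/
theorem modulation_eq_of_max_angular {U₁τ U₁ yGradU₁ U₁z convU₁ Ψ₁z L₃U₁ a ζ : ℝ}
    (heq : U₁τ + a * (2 * U₁ + yGradU₁) + ζ * U₁z + convU₁ = 2 * U₁ * Ψ₁z + L₃U₁)
    (hU : U₁ = 1) (hy : yGradU₁ = 0) (hz : U₁z = 0) (hconv : convU₁ = 0) (hτ : U₁τ = 0) :
    a = Ψ₁z + L₃U₁ / 2 := by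
  subst hU hy hz hconv hτ
  linarith

end GaugeNb

end TypeIIModulationDictionary
end Summit.NavierStokesRegularity.OSWSelfSimilar
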